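import Summits.QuantumFields.YangMills.Theorems.BalabanLadderUVSeamRecCeilingsResponseMomentsUnit
import HarnessLib

/-!
# Crux `UVSeamRec` (stmt-QuantumFields-20043), slot `stub_ceilings`, v5(α): the NAMED response-moment binder (RM) at `SU(2)`,
# fundamental representation, in a one-sided window to the unit of record — and its one-line bridge to `stub_ceilings`' conclusion

Definitions file of the route object posited by the owner's ruling R86g/R86j (ym-beyond INBOX 2026-08-27T12:49Z/13:16Z; typist: unit
`ym-20043-tempered-d1`): `ResponseMomentsOdd6SU2 : Prop` is EXACTLY the hypothesis of ceilings-p2's press-button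
`TemperedResponse.stubCeilings_of_responseMoments` (p532738, `…CeilingsResponseMomentsUnit.lean` 8568c3e0ff752c15), named so that the v5(α)
stub `stub_responseMomentsOdd6 : UV → ResponseMomentsOdd6SU2` is closed BY NAME and `stub_ceilings` is a theorem through
`stubCeilings_of_responseMomentsOdd6SU2`.  HONEST FRAMING: a definition and a one-line bridge; (RM) — β-uniform joint exponential RESPONSE
MOMENTS of the femto plane kernels on every odd torus — is an OPEN renormalisation-group statement (E0′-K with background field + uniform
analyticity in local sources), STRONGER than `MomentBounds6`; nothing of it, nothing of E0′ is asserted here; not a gap, not Clay.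
Calibration of record (ceilings-p2 #54): free field `det(1−M)^{−1/2}` with operator norms; inhabited at high temperature by p533459
`abs_torusE_prod_sub_le_smallBeta`; discharge architecture (β) = Bałaban's small-field/large-field split with the influence functional of
`…PolymerData`/`…PolymerInfluence` (p531519/p533172) as the large-field correction.
-/

set_option autoImplicit false

noncomputable section

open MeasureTheory Filter Topology Finset
open Literature.MathematicalPhysics.QuantumFieldTheory (LatticeRep)
open Literature.MathematicalPhysics.QuantumLattice
open Summit.QuantumFields.YangMills.Cruxes.OSLegsFromFemtoAndGap.DlrCollarTransfer

namespace Summit.QuantumFields.YangMills.Cruxes.UVSeamRec.ResponseMomentsDefs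

/-- **(RM) — RESPONSE MOMENTS ON ODD TORI, `SU(2)` fundamental, in a window to the unit of record.**  There are a unit map `a` with
`a ≤ c·uRec` eventually (`c > 0`), constants `C₁ > 0`, `B`, `β₁`, `ℓ₁ > 0`, `P₀` and bounded means `p q β` (`|p| ≤ P₀`) such that for
`β ≥ β₁`, on every odd torus `(ℤ/(2L+1))⁴`, for every string of orientations `q i` (`(q i).1 < (q i).2`), sites `x i`, radius `1 ≤ R` with
`R·a β ≤ ℓ₁`, `4R+8 ≤ L`, pairwise cyclically `2R+4`-separated in some coordinate, and every index set `T`: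
`⟨exp(Σ_{i∈T} (R⁴/C₁)·|kerE_{cube(x i, R+1)}(plane (q i) (x i) | U) − p (q i) β|)⟩_{2L+1,β} ≤ exp(B·#T)` — the joint exponential moments
of the femto plane-kernel RESPONSES are multiplicatively bounded, β-uniformly (the hypothesis of p532738 VERBATIM; stronger than
`MomentBounds6 SU(2) rF uRec`, which it implies through p532025 ⊕ the flow window).  OPEN. -/
def ResponseMomentsOdd6SU2 : Prop :=
  letI : MeasurableSpace (Matrix.specialUnitaryGroup (Fin 2) ℂ) := borel _
  haveI : BorelSpace (Matrix.specialUnitaryGroup (Fin 2) ℂ) := ⟨rfl⟩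
  ∃ (a : ℝ → ℝ) (c : ℝ) (C₁ B β₁ ℓ₁ P₀ : ℝ) (p : Fin 4 × Fin 4 → ℝ → ℝ), 0 < c ∧
    (∀ᶠ β in atTop, a β ≤ c * Transport.uRec β) ∧ 0 < ℓ₁ ∧ 0 < C₁ ∧ (∀ q β, |p q β| ≤ P₀) ∧
    ∀ β : ℝ, β₁ ≤ β → ∀ (L n : ℕ) (q : Fin n → Fin 4 × Fin 4) (x : Fin n → (Fin 4 → ℤ)) (R : ℕ),
      (∀ i, (q i).1 < (q i).2) → 1 ≤ R → (R : ℝ) * a β ≤ ℓ₁ → 4 * R + 8 ≤ L →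
      (∀ i j : Fin n, i ≠ j → ∃ k : Fin 4,
        (2 * (R : ℤ) + 4) ≤ |((((x i k - x j k : ℤ) : ZMod (2 * L + 1))).valMinAbs : ℤ)|) →
      ∀ T : Finset (Fin n),
        torusE (Matrix.specialUnitaryGroup (Fin 2) ℂ) (fundamentalLatticeRep 2) β L
          (fun U => Real.exp (∑ i ∈ T, (R : ℝ) ^ 4 / C₁ *
            |kerE (Matrix.specialUnitaryGroup (Fin 2) ℂ) (fundamentalLatticeRep 2) β
              (fun k => x i k - (R + 1)) (2 * R + 3) U
              (plane (Matrix.specialUnitaryGroup (Fin 2) ℂ) (fundamentalLatticeRep 2) (q i) (x i)) -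
              p (q i) β|)) ≤ Real.exp (B * T.card)

/-- **THE BRIDGE**: (RM) ⇒ the conclusion of the registered `stub_ceilings` verbatim, `MomentBounds6 SU(2) rF uRec` — ceilings-p2's
`TemperedResponse.stubCeilings_of_responseMoments` (p532738) applied to the named binder. [folklore] -/
theorem stubCeilings_of_responseMomentsOdd6SU2 (h : ResponseMomentsOdd6SU2) :
    letI : MeasurableSpace (Matrix.specialUnitaryGroup (Fin 2) ℂ) := borel _
    haveI : BorelSpace (Matrix.specialUnitaryGroup (Fin 2) ℂ) := ⟨rfl⟩
    MomentBounds6 (Matrix.specialUnitaryGroup (Fin 2) ℂ) (fundamentalLatticeRep 2) Transport.uRec :=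
  TemperedResponse.stubCeilings_of_responseMoments h

/-- **UNFOLD LEMMA** (owner ruling R86l (2), ym-beyond INBOX 2026-08-27T13:59Z): `ResponseMomentsOdd6SU2 ↔ H` with `H` the hypothesis of
p532738 `TemperedResponse.stubCeilings_of_responseMoments` = the body of the REGISTERED v5(α) stub `stub_responseMomentsOdd6` (skeleton
afcf556d5b76a240) printed VERBATIM (`Literature.MathematicalPhysics.QuantumLattice.fundamentalLatticeRep 2`, `Transport.uRec`) — so a supplier
STATES its theorem against the name (`… : ResponseMomentsOdd6SU2`) and a closer DISCHARGES the registered verbatim stub by one rewrite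
(`exact responseMomentsOdd6SU2_iff.1 h`; equally `Iff.rfl` / `delta`).  Definitional (`Iff.rfl`). [folklore] -/
theorem responseMomentsOdd6SU2_iff :
    ResponseMomentsOdd6SU2 ↔
      (letI : MeasurableSpace (Matrix.specialUnitaryGroup (Fin 2) ℂ) := borel _
      haveI : BorelSpace (Matrix.specialUnitaryGroup (Fin 2) ℂ) := ⟨rfl⟩
      ∃ (a : ℝ → ℝ) (c : ℝ) (C₁ B β₁ ℓ₁ P₀ : ℝ) (p : Fin 4 × Fin 4 → ℝ → ℝ), 0 < c ∧
      (∀ᶠ β in atTop, a β ≤ c * Transport.uRec β) ∧ 0 < ℓ₁ ∧ 0 < C₁ ∧ (∀ q β, |p q β| ≤ P₀) ∧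
      ∀ β : ℝ, β₁ ≤ β → ∀ (L n : ℕ) (q : Fin n → Fin 4 × Fin 4) (x : Fin n → (Fin 4 → ℤ)) (R : ℕ),
      (∀ i, (q i).1 < (q i).2) → 1 ≤ R → (R : ℝ) * a β ≤ ℓ₁ → 4 * R + 8 ≤ L →
      (∀ i j : Fin n, i ≠ j → ∃ k : Fin 4,
      (2 * (R : ℤ) + 4) ≤ |((((x i k - x j k : ℤ) : ZMod (2 * L + 1))).valMinAbs : ℤ)|) →
      ∀ T : Finset (Fin n),
      torusE (Matrix.specialUnitaryGroup (Fin 2) ℂ) (Literature.MathematicalPhysics.QuantumLattice.fundamentalLatticeRep 2) β L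
      (fun U => Real.exp (∑ i ∈ T, (R : ℝ) ^ 4 / C₁ *
      |kerE (Matrix.specialUnitaryGroup (Fin 2) ℂ) (Literature.MathematicalPhysics.QuantumLattice.fundamentalLatticeRep 2) β
      (fun k => x i k - (R + 1)) (2 * R + 3) U
      (plane (Matrix.specialUnitaryGroup (Fin 2) ℂ) (Literature.MathematicalPhysics.QuantumLattice.fundamentalLatticeRep 2) (q i) (x i)) -
      p (q i) β|)) ≤ Real.exp (B * T.card)) :=
  Iff.rfl

end Summit.QuantumFields.YangMills.Cruxes.UVSeamRec.ResponseMomentsDefs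

end
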